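import Mathlib

/-!
# Route `FilamentSkeletonRss` · child crux `TangentSkeletonNearStraightL` (stmt-NavierStokesRegularity-23320) · registered line
# `child_tangent_analytic_strip_L` (b0b56c52900dd90a), stub `stub_stripPropagation` — brick: THE NEAR-DIAGONAL LOGARITHM

Where the `log Γ` of the stub's bound `Cu·√Γ·log Γ` comes from (R7 of the STUB-PLAN memo attached to 23320): on the shifted near-diagonal segment the
complexified matched kernel is bounded by `numerator/denominator ≤ (2·B₁·K₂·s²)·((1−6η²)s² + κA/2)^{-3/2}` (`Theorems.StadiumCauchyNumerator`,
`Theorems.StadiumChord`, `Theorems.StadiumKernelPieces`), i.e. by a multiple of `s²/(c s² + μ²)^{3/2}`; its integral is logarithmic in `R/μ`: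
* `rpow_threeHalves_sq` — `(x²)^{3/2} = x³` for `x ≥ 0`;
* `integral_sq_div_rpow_threeHalves_le` — for `0 < c`, `0 < μ`, `μ/√c ≤ R`:
  `∫₀^R s²/(c s² + μ²)^{3/2} ds ≤ (1/3 + log(R√c/μ))/c^{3/2}` (split at `s₀ = μ/√c`: `≤ s²/μ³` below, `≤ 1/(c^{3/2}s)` above).
With `μ² = κ/(2Λ)`, `c = 1 − 6η²`, `R ≤ hs = cs√Γ`: `log(R√c/μ) = O(log Γ)`, whence `Cu√Γ log Γ` after the prefactor `Γθ₀⁻¹/(4π)·8/hs`.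
HONEST FRAMING: a calculus brick for a plan about a HYPOTHETICAL filament skeleton on the NEGATIVE side of a MODEL route; the stub `stub_stripPropagation`
is NOT closed; nothing here bears on Navier–Stokes regularity or blow-up.  `--supports stmt-NavierStokesRegularity-23320`.
-/

set_option linter.dupNamespace false

noncomputable section

namespace Summit.NavierStokesRegularity.NavierStokesRegularity.Theorems.NearDiagonalLogIntegral

open Set MeasureTheory intervalIntegral

/-- `(x²)^{3/2} = x³` for `x ≥ 0`. [folklore] -/
theorem rpow_threeHalves_sq {x : ℝ} (hx : 0 ≤ x) : (x ^ 2) ^ (3/2 : ℝ) = x ^ 3 := by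
  rw [← Real.rpow_two, ← Real.rpow_mul hx]
  norm_num

/-- **The near-diagonal logarithm.**  For `0 < c`, `0 < μ` and `μ/√c ≤ R`:
`∫₀^R s²/(c s² + μ²)^{3/2} ds ≤ (1/3 + log(R√c/μ)) / c^{3/2}`. [folklore] -/
theorem integral_sq_div_rpow_threeHalves_le {c μ R : ℝ} (hc : 0 < c) (hμ : 0 < μ) (hR : μ / Real.sqrt c ≤ R) :
    ∫ s in (0:ℝ)..R, s ^ 2 / (c * s ^ 2 + μ ^ 2) ^ (3/2 : ℝ) ≤
      (1/3 + Real.log (R * Real.sqrt c / μ)) / c ^ (3/2 : ℝ) := by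
  set p : ℝ := c ^ (3/2 : ℝ) with hp
  have hp0 : 0 < p := Real.rpow_pos_of_pos hc _
  have hsc : 0 < Real.sqrt c := Real.sqrt_pos.2 hc
  set s₀ : ℝ := μ / Real.sqrt c with hs₀
  have hs₀0 : 0 < s₀ := div_pos hμ hsc
  have hR0 : 0 < R := hs₀0.trans_le hR
  -- `(√c)³ = c^{3/2}` and `s₀³ = μ³/p`
  have hsqrt3 : Real.sqrt c ^ 3 = p := by
    rw [hp, Real.sqrt_eq_rpow, ← Real.rpow_natCast (c ^ (1/2:ℝ)) 3, ← Real.rpow_mul hc.le]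
    norm_num
  have hs₀3 : s₀ ^ 3 = μ ^ 3 / p := by rw [hs₀, div_pow, hsqrt3]
  -- the integrand and its continuity
  set f : ℝ → ℝ := fun s => s ^ 2 / (c * s ^ 2 + μ ^ 2) ^ (3/2 : ℝ) with hf
  have hden_pos : ∀ s : ℝ, 0 < (c * s ^ 2 + μ ^ 2) ^ (3/2 : ℝ) := fun s =>
    Real.rpow_pos_of_pos (by positivity) _
  have hf_cont : Continuous f := by
    have h1 : Continuous fun s : ℝ => (c * s ^ 2 + μ ^ 2) ^ (3/2 : ℝ) :=
      Continuous.rpow_const (by fun_prop) fun s => Or.inr (by norm_num)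
    exact (continuous_pow 2).div h1 fun s => (hden_pos s).ne'
  have hfi : ∀ a b : ℝ, IntervalIntegrable f volume a b := fun a b => hf_cont.intervalIntegrable a b
  -- split at `s₀`
  rw [← integral_add_adjacent_intervals (hfi 0 s₀) (hfi s₀ R)]
  -- part 1: `[0, s₀]`, `f ≤ s²/μ³`
  have hpart1 : ∫ s in (0:ℝ)..s₀, f s ≤ 1 / (3 * p) := by
    have hle : ∀ s ∈ Icc 0 s₀, f s ≤ s ^ 2 / μ ^ 3 := by
      intro s _
      have hden : μ ^ 3 ≤ (c * s ^ 2 + μ ^ 2) ^ (3/2 : ℝ) := by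
        rw [← rpow_threeHalves_sq hμ.le]
        exact Real.rpow_le_rpow (sq_nonneg μ) (by nlinarith [sq_nonneg s]) (by norm_num)
      exact div_le_div_of_nonneg_left (sq_nonneg s) (by positivity) hden
    have hmono := integral_mono_on hs₀0.le (hfi 0 s₀) ((continuous_pow 2).div_const _ |>.intervalIntegrable 0 s₀) hle
    refine hmono.trans (le_of_eq ?_)
    rw [intervalIntegral.integral_div, integral_pow, hs₀3]
    field_simp
    ring
  -- part 2: `[s₀, R]`, `f ≤ 1/(p s)`
  have hpart2 : ∫ s in s₀..R, f s ≤ Real.log (R * Real.sqrt c / μ) / p := by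
    have hle : ∀ s ∈ Icc s₀ R, f s ≤ p⁻¹ * s⁻¹ := by
      intro s hs
      have hs0 : 0 < s := hs₀0.trans_le hs.1
      have hden : p * s ^ 3 ≤ (c * s ^ 2 + μ ^ 2) ^ (3/2 : ℝ) := by
        have h1 : (c * s ^ 2) ^ (3/2 : ℝ) = p * s ^ 3 := by
          rw [Real.mul_rpow hc.le (sq_nonneg s), rpow_threeHalves_sq hs0.le]
        rw [← h1]
        exact Real.rpow_le_rpow (by positivity) (by nlinarith [sq_nonneg μ]) (by norm_num)
      calc f s = s ^ 2 / (c * s ^ 2 + μ ^ 2) ^ (3/2 : ℝ) := rfl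
        _ ≤ s ^ 2 / (p * s ^ 3) := div_le_div_of_nonneg_left (sq_nonneg s) (by positivity) hden
        _ = p⁻¹ * s⁻¹ := by field_simp
    have hgi : IntervalIntegrable (fun s : ℝ => p⁻¹ * s⁻¹) volume s₀ R := by
      refine (ContinuousOn.intervalIntegrable ?_)
      refine ContinuousOn.mul continuousOn_const (continuousOn_inv₀.mono ?_)
      intro s hs
      rw [uIcc_of_le hR] at hs
      exact (hs₀0.trans_le hs.1).ne'
    have hmono := integral_mono_on hR (hfi s₀ R) hgi hle
    refine hmono.trans (le_of_eq ?_)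
    rw [intervalIntegral.integral_const_mul, integral_inv_of_pos hs₀0 hR0, hs₀, div_div_eq_mul_div, inv_mul_eq_div]
  -- assembly
  have hsum : 1 / (3 * p) + Real.log (R * Real.sqrt c / μ) / p = (1/3 + Real.log (R * Real.sqrt c / μ)) / p := by
    field_simp
  calc (∫ s in (0:ℝ)..s₀, f s) + ∫ s in s₀..R, f s ≤ 1 / (3 * p) + Real.log (R * Real.sqrt c / μ) / p :=
        add_le_add hpart1 hpart2
    _ = (1/3 + Real.log (R * Real.sqrt c / μ)) / p := hsum

end Summit.NavierStokesRegularity.NavierStokesRegularity.Theorems.NearDiagonalLogIntegral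

end
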